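import Mathlib
import HarnessLib
import Summits.ValiantsHypothesis.ValiantsHypothesis.Theses.MonotoneRestoration
import Literature.Computability.AlgebraicComplexity.ArithCircuit
import Literature.Computability.AlgebraicComplexity.ArithCircuitProofs
import Literature.Computability.AlgebraicComplexity.MonotoneStructure
import Literature.Computability.AlgebraicComplexity.PermanentIrreducible
import Literature.ModelTheory.FiniteModelTheory.CkEquiv
import Summits.ValiantsHypothesis.ValiantsHypothesis.Theorems.MonotoneRestorationMonotoneRestorationQPCosetCount
import Summits.ValiantsHypothesis.ValiantsHypothesis.Theorems.MonotoneRestorationMonotoneRestorationQPSymmetricLB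
import Summits.ValiantsHypothesis.ValiantsHypothesis.Theorems.MonotoneRestorationMonotoneRestorationQPSupportSymmetrisation
import Summits.ValiantsHypothesis.ValiantsHypothesis.Theorems.MonotoneRestorationMonotoneRestorationQPSparseRegime
import Summits.ValiantsHypothesis.ValiantsHypothesis.Theorems.MonotoneRestorationMonotoneRestorationQPBeta
import Literature.Computability.AlgebraicComplexity.SymmetricArithCircuit
import Literature.Computability.AlgebraicComplexity.DawarWilsenach2025Proofs
import Literature.GroupTheory.PermutationGroups.SmallIndexSubgroups
import Summits.ValiantsHypothesis.ValiantsHypothesis.Theorems.MonotoneRestorationQP.Negative.LoadBearing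
import Summits.ValiantsHypothesis.ValiantsHypothesis.Theorems.MonotoneRestorationMonotoneRestorationQPPermSupportCount

/-! TTRL-lite variant V19921 of stmt-ValiantsHypothesis-15886 -/

-- `Summit.ValiantsHypothesis.ValiantsHypothesis.…` is the tree's mandated single-conjunct layout
-- (Sub = Summit), so the duplicated namespace component is intended.
set_option linter.dupNamespace false

namespace Summit.ValiantsHypothesis.ValiantsHypothesis.Theorems

open Summit.ValiantsHypothesis.ValiantsHypothesis.Theses.MonotoneRestoration
open Literature.Computability.AlgebraicComplexity

/-- **TTRL-lite variant V19921 of `stub_mulGate_children_extend`** (quantitative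
no-cancellation over `ℝ≥0`): for `p q : MvPolynomial (Fin n × Fin n) ℝ≥0` and monomials `m m'`,
`coeff m p * coeff m' q ≤ coeff (m + m') (p * q)`.
By `MvPolynomial.coeff_mul` the right-hand side is the sum of `coeff a p * coeff b q` over the
antidiagonal of `m + m'`, which contains `(m, m')`; every term is nonnegative in `ℝ≥0`, so the
single term is bounded by the sum (`Finset.single_le_sum`). This is the coefficient inequality
underneath `add_mem_support_mul`. [folklore] -/
theorem stub_mulGate_children_extend_var19921 :
    ∀ (n : ℕ) (p q : MvPolynomial (Fin n × Fin n) NNReal) (m m' : (Fin n × Fin n) →₀ ℕ),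
      MvPolynomial.coeff m p * MvPolynomial.coeff m' q ≤ MvPolynomial.coeff (m + m') (p * q) := by
  intro n p q m m'
  rw [MvPolynomial.coeff_mul]
  have hmem : (m, m') ∈ Finset.HasAntidiagonal.antidiagonal (m + m') :=
    Finset.HasAntidiagonal.mem_antidiagonal.mpr rfl
  exact Finset.single_le_sum (f := fun x : ((Fin n × Fin n) →₀ ℕ) × ((Fin n × Fin n) →₀ ℕ) =>
      MvPolynomial.coeff x.1 p * MvPolynomial.coeff x.2 q) (fun _ _ => zero_le) hmem

end Summit.ValiantsHypothesis.ValiantsHypothesis.Theorems
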